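import Literature.AlgebraicGeometry.Motives.AlgebraicClassesKunnethFullyAlgebraicFactor
import Literature.AlgebraicGeometry.Motives.TateConjectureStrongFormFiniteField
import Literature.AlgebraicGeometry.Motives.StandardConjecturesHomNumProofs
import Literature.AlgebraicGeometry.Motives.ProjectiveSpaceFiniteFieldCohomology
import HarnessLib

/-!
# Hom = num (standard conjecture `D`) transported along a factor with fully algebraic cohomology:
# `D(X × Z) ⟺ D(X)` for `Z` with `K·A(Z) = H^{ev}(Z)`, `b_{odd}(Z) = 0`; `D(X × 𝐏ʳ) ⟺ D(X)`

Topic `Literature/AlgebraicGeometry/Motives`; THEOREMS ONLY (no definition, no instance, no named fact;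
D-0026).

For `X`, `Z` smooth projective of dimensions `n`, `m` over a field `k` and a Weil cohomology `W` with
coefficients `K ⊇ ℚ`, write `Eᵖ(X)` (Tate's `E`, Milne) for «the Poincaré pairing
`K·Aᵖ(X) × K·A^{n−p}(X) → K` has trivial left kernel», i.e. hom = num in codimension `p` (equivalently with
`ℚ`-classes, the tree's `homNum_iff_algebraicClasses`); the standard conjecture `D(X)`
(`WeilCohomology.StandardConjectureD`, Kleiman 1968 §3) is `Eᵖ(X)` for all `p`.  Kleiman 1968 §3 proves
`D(X × Z) ⟹ D(X)` (the tree's `standardConjectureD_of_standardConjectureD_tensor`).  Here, for a factor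
`Z` whose cohomology is fully algebraic — `K·A^q(Z) = H^{2q}(Z)` for all `q` and `b_{odd}(Z) = 0`
(projective spaces, Grassmannians, flag varieties, cellular varieties; Fulton Ex. 1.10.2, Th. 3.3 (b),
Kahn Prop. 6.11–6.12 for `𝐏¹`) — the converse holds, bidegree by bidegree:

* §1 (any `W`) **the adjunction identity** `⟨a, x × w⟩_{X×Z} = ⟨pr_{X*}(a ∪ pr_Z^* w), x⟩_X`
  (`cupPairing_right_externalCup`; `f₊ ⊣ f^*` for the Poincaré pairing, Kahn §3.5.1, and
  `(a ∪ pr_Z^* w) ∪ pr_X^* x = a ∪ (x × w)`).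
* §2 **`Eᶜ(X × Z) ⟹ Eᵖ(X)` for every `p + q = c` with `H^{2q}(Z) ≠ 0`** (`homNum_of_homNum_tensor`: for
  `x ∈ K·Aᵖ(X)` orthogonal to `K·A^{n−p}(X)` and `0 ≠ w ∈ H^{2q}(Z) = K·A^q(Z)`, `x × w` is algebraic and
  orthogonal to `K·A^{c′}(X × Z)` by §1, so `x × w = 0`, so `x = 0`).
* §3 **`Eᵖ(X)` for all `p + q = c` with `H^{2q}(Z) ≠ 0` ⟹ `Eᶜ(X × Z)`** (`homNum_tensor_of_forall`): an
  algebraic `a ∈ H^{2c}(X × Z)` orthogonal to `K·A^{c′}(X × Z)` has every Künneth component `a_{2p,2q} = 0`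
  (`kunnethComponent_eq_zero_of_forall_cupPairing_eq_zero`) — its contractions
  `pr_{X*}(a ∪ pr_Z^* b′) ∈ K·Aᵖ(X)` (row g53-#1) are orthogonal to `K·A^{n−p}(X)` by §1, hence vanish —
  so `a = Σ ext(a_{i,j}) = 0`; and the equivalence `homNum_tensor_iff`.
* §4 **`D(X × Z) ⟺ D(X)`** (`standardConjectureD_tensor_iff`, with Kleiman's direction from the tree), and
  over a finite field in a Galois-compatible theory with the trace formula and RH for `𝐏ʳ`,
  **`D(X × 𝐏ʳ) ⟺ D(X)`** (`standardConjectureD_tensor_projectiveSpace_iff`).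

HC is not touched; `D` itself stays open (an `@[conjecture]` predicate of the tree) — only implications
between its instances are proved.

## References

* [Kleiman1968AlgebraicCycles] S. Kleiman, *Algebraic cycles and the Weil conjectures*, in: Dix exposés sur
  la cohomologie des schémas (1968), §1.2 (A)–(B) (Poincaré duality, Künneth), §3 `D(X)`, `D(X × Y) ⟹ D(X)`.
* [Kahn2020] B. Kahn, *Zeta and L-Functions of Varieties and Motives* (2020), §3.5.1 (`f_*` adjoint to `f^*`,
  projection formula), §6.4 Prop. 6.11 (6.4.1)–Prop. 6.12 (`A_∼(X × 𝐏¹) = A_∼(X) ⊕ A_∼(X)` for every adequate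
  `∼`), §6.12.2 (conjecture `D`).
* [Fulton1998] W. Fulton, *Intersection Theory*, 2nd ed. (1998), Ex. 1.10.2 (cellular Künneth), Th. 3.3 (b).
* [Roman2008] S. Roman, *Advanced Linear Algebra* (2008), Ch. 14 Th. 14.5 (`Σ uᵢ ⊗ vᵢ = 0` with independent
  `vᵢ` forces `uᵢ = 0`: contraction against the dual basis).
* [Hartshorne1977] R. Hartshorne, *Algebraic Geometry* (1977), App. C Ex. 5.2 (cohomology of `𝐏ʳ_{𝔽_q}`).
* Tree: row g53-#1 `AlgebraicClassesKunnethFullyAlgebraicFactor` (`pushforward_fst_cup_snd_eq_rid_lTensor_kunnethComponent`,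
  `pushforward_fst_cup_snd_mem_algebraicClasses`, `map₂_externalCup_algebraicClasses_top_le`,
  `mem_map₂_top_of_forall_rid_lTensor_mem`, `kunnethComponent_eq_zero_of_odd_right`),
  `TateConjectureStrongFormFiniteField` (`homNum_iff_algebraicClasses`), `StandardConjecturesHomNumProofs`
  (`standardConjectureD_of_standardConjectureD_tensor`), `CorrespondencesCompProofs` (`trace_cup_pushforward`),
  `FrobeniusSemisimpleOfSelfProductTate` (`externalCup_ne_zero`), `ProjectiveSpaceFiniteFieldCohomology`.

## Provenance

Lane `lit-hodgefound` (summit `HodgeConjecture`, Track 2 foundations library, Layer B: motives — algebraic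
classes, Künneth decompositions, standard conjectures), seat `lit-hodgefound-p29` (literature-prover,
generation 53, row g53-#7).
-/

universe u v

open CategoryTheory AlgebraicGeometry MonoidalCategory CartesianMonoidalCategory
open scoped TensorProduct

namespace Literature.AlgebraicGeometry.Motives

namespace WeilCohomology

open Literature.LinearAlgebra.TensorContraction

variable {k : Type u} [Field k] {K : Type v} [Field K] [CharZero K] (W : WeilCohomology k K)
variable {n m : ℕ} {X Z : SchemeOver k}

/-! ### §1 The adjunction identity `⟨a, x × w⟩_{X×Z} = ⟨pr_{X*}(a ∪ pr_Z^* w), x⟩_X` -/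

/-- **Adjunction identity**: for `a ∈ H^{c₁}(X × Z)`, `x ∈ Hⁱ(X)`, `w ∈ Hʲ(Z)` (`i` or `j` even),
`tr_{X×Z}(a ∪ (x × w)) = tr_X(pr_{X*}(a ∪ pr_Z^* w) ∪ x)` — `pr_{X*}` is the Poincaré adjoint of `pr_X^*`
(`tr_X(f₊ α ∪ β) = tr(α ∪ f^* β)`, Kahn §3.5.1) and `(a ∪ pr_Z^* w) ∪ pr_X^* x = a ∪ (pr_X^* x ∪ pr_Z^* w)`
(associativity, graded commutativity in even degree).  Degrees: `i + j = e`, `c₁ + e = 2(n + m)`, `c₁ + j = s`,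
`s + i = 2(n + m)`, `d′ + i = 2n`. [cite: Kahn2020, §3.5.1] [cite: Kleiman1968AlgebraicCycles, §1.2 (A)–(B)] -/
theorem cupPairing_right_externalCup (hX : IsSmoothProjective n X) (hZ : IsSmoothProjective m Z)
    {c₁ i j e s d' : ℕ} (hij : i + j = e) (h' : c₁ + e = 2 * (n + m)) (hs : c₁ + j = s)
    (he : s + i = 2 * (n + m)) (hd : d' + i = 2 * n) (heven : Even i ∨ Even j)
    (a : W.obj (X ⊗ Z) c₁) (x : W.obj X i) (w : W.obj Z j) :
    W.cupPairing (X ⊗ Z) (n + m) c₁ e h' a (W.externalCup X Z hij x w) =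
      W.cupPairing X n d' i hd
        (W.pushforward (N := n + m) hX (fst X Z) he hd (W.cup hs a (W.pullback (snd X Z) j w))) x := by
  have hXZ := IsSmoothProjective.tensor_holds hX hZ
  rw [W.cupPairing_apply, W.cupPairing_apply, W.trace_cup_pushforward,
    W.cup_assoc hXZ hs (show j + i = e by omega) he h', W.externalCup_apply,
    W.cup_comm_of_even hXZ hij (show j + i = e by omega) heven]

/-! ### §2 `Eᶜ(X × Z) ⟹ Eᵖ(X)` -/

/-- **Hom = num descends from `X × Z` to `X`, bidegree form**: if the Poincaré pairing
`K·Aᶜ(X × Z) × K·A^{c′}(X × Z) → K` (`c + c′ = n + m`) has trivial left kernel, then so has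
`K·Aᵖ(X) × K·A^{p′}(X) → K` for every `p + q = c`, `p + p′ = n` with `H^{2q}(Z) ≠ 0`, provided
`K·A^q(Z) = H^{2q}(Z)`: for `x` in the kernel and `0 ≠ w ∈ H^{2q}(Z)`, `x × w ∈ K·Aᶜ(X × Z)` is orthogonal to
`K·A^{c′}(X × Z)` (`⟨x × w, a′⟩ = ⟨x, pr_{X*}(a′ ∪ pr_Z^* w)⟩ = 0`, the transfer being algebraic), so
`x × w = 0` and `x = 0` (Künneth).  Kleiman's `D(X × Z) ⟹ D(X)` uses `q = 0`, `w = 1`.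
[cite: Kleiman1968AlgebraicCycles, §3 and §1.2 (A)–(B)] [cite: Kahn2020, §3.5.1 and §6.12.2] -/
theorem homNum_of_homNum_tensor (hX : IsSmoothProjective n X) (hZ : IsSmoothProjective m Z)
    (hZalg : ∀ q, W.algebraicClasses Z q = ⊤) {c c' p q p' : ℕ} (hpq : p + q = c) (hpp' : p + p' = n)
    (hcc' : c + c' = n + m) (hZq : Nontrivial (W.obj Z (2 * q))) (h : 2 * c + 2 * c' = 2 * (n + m))
    (hp : 2 * p + 2 * p' = 2 * n)
    (hD : ∀ a ∈ W.algebraicClasses (X ⊗ Z) c, (∀ a' ∈ W.algebraicClasses (X ⊗ Z) c',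
        W.cupPairing (X ⊗ Z) (n + m) (2 * c) (2 * c') h a a' = 0) → a = 0) :
    ∀ x ∈ W.algebraicClasses X p, (∀ x' ∈ W.algebraicClasses X p',
        W.cupPairing X n (2 * p) (2 * p') hp x x' = 0) → x = 0 := by
  have hXZ := IsSmoothProjective.tensor_holds hX hZ
  intro x hx hperp
  obtain ⟨w, hw⟩ := exists_ne (0 : W.obj Z (2 * q))
  have hqm : q ≤ m := by
    by_contra hlt
    haveI := W.subsingleton_obj hZ (i := 2 * q) (by omega)
    exact hw (Subsingleton.elim _ _)
  by_contra hx0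
  refine W.externalCup_ne_zero hX hZ (show 2 * p + 2 * q = 2 * c by omega) hx0 hw
    (hD _ ?_ fun a' ha' ↦ ?_)
  · exact W.map₂_externalCup_algebraicClasses_top_le hX hZ hpq (hZalg q) _
      (Submodule.apply_mem_map₂ _ hx Submodule.mem_top)
  · -- `⟨x × w, a′⟩ = ⟨a′, x × w⟩ = ⟨pr_{X*}(a′ ∪ pr_Z^* w), x⟩ = ⟨x, pr_{X*}(a′ ∪ pr_Z^* w)⟩ = 0`
    rw [W.cupPairing_apply, W.cup_comm_of_even hXZ h (show 2 * c' + 2 * c = 2 * (n + m) by omega)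
      (Or.inl ⟨c, two_mul c⟩), ← W.cupPairing_apply,
      W.cupPairing_right_externalCup hX hZ (show 2 * p + 2 * q = 2 * c by omega) _
        (s := 2 * (c' + q)) (by omega) (d' := 2 * p') (by omega) (by omega) (Or.inl ⟨p, two_mul p⟩),
      W.cupPairing_apply, W.cup_comm_of_even hX _ hp (Or.inl ⟨p', two_mul p'⟩), ← W.cupPairing_apply]
    exact hperp _ (W.pushforward_fst_cup_snd_mem_algebraicClasses hX hZ (r := c' + q) rfl (by omega)
      (by omega) (by omega) ha' (by rw [hZalg]; exact Submodule.mem_top))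

/-! ### §3 `Eᵖ(X)` for the relevant `p` ⟹ `Eᶜ(X × Z)` -/

/-- **The Künneth components of an algebraic class orthogonal to `K·A^{c′}(X × Z)` vanish** when hom = num
holds on `X` in the bidegrees `(p, n − p)`, `p + q = c`, `H^{2q}(Z) ≠ 0` (for `Z` with `K·A^q(Z) = H^{2q}(Z)`
for all `q`, `b_{odd}(Z) = 0`): the contraction of `a_{2p,2q}` against `tr_Z(− ∪ b′)` is
`pr_{X*}(a ∪ pr_Z^* b′) ∈ K·Aᵖ(X)` (row g53-#1), and `⟨pr_{X*}(a ∪ pr_Z^* b′), x′⟩_X = ⟨a, x′ × b′⟩ = 0` for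
`x′ ∈ K·A^{n−p}(X)` (`x′ × b′` is algebraic), so every contraction vanishes and `a_{2p,2q} = 0` (Roman Th. 14.5);
odd and out-of-range bidegrees are zero outright. [cite: Kleiman1968AlgebraicCycles, §3 and §1.2 (A)–(B)]
[cite: Kahn2020, §3.5.1 and §6.4 Prop. 6.11–6.12] [cite: Roman2008, Ch. 14 Th. 14.5] -/
theorem kunnethComponent_eq_zero_of_forall_cupPairing_eq_zero (hX : IsSmoothProjective n X)
    (hZ : IsSmoothProjective m Z) (hZalg : ∀ q, W.algebraicClasses Z q = ⊤)
    (hZodd : ∀ j, Odd j → Module.finrank K (W.obj Z j) = 0) {c c' : ℕ} (hcc' : c + c' = n + m)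
    (h : 2 * c + 2 * c' = 2 * (n + m))
    (hD : ∀ p q p' : ℕ, p + q = c → (hp : 2 * p + 2 * p' = 2 * n) → Nontrivial (W.obj Z (2 * q)) →
      ∀ x ∈ W.algebraicClasses X p, (∀ x' ∈ W.algebraicClasses X p',
        W.cupPairing X n (2 * p) (2 * p') hp x x' = 0) → x = 0)
    {a : W.obj (X ⊗ Z) (2 * c)} (ha : a ∈ W.algebraicClasses (X ⊗ Z) c)
    (hperp : ∀ a' ∈ W.algebraicClasses (X ⊗ Z) c', W.cupPairing (X ⊗ Z) (n + m) (2 * c) (2 * c') h a a' = 0)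
    {i j : ℕ} (hij : i + j = 2 * c) : W.kunnethComponent hX hZ i j hij a = 0 := by
  rcases Nat.even_or_odd j with hj | hj
  · obtain ⟨q, rfl⟩ : ∃ q, j = 2 * q := ⟨j / 2, by have := Nat.even_iff.mp hj; omega⟩
    obtain ⟨p, rfl⟩ : ∃ p, i = 2 * p := ⟨c - q, by omega⟩
    by_cases hqm : m < q
    · haveI := W.subsingleton_obj hZ (i := 2 * q) (by omega)
      exact eq_zero_of_subsingleton_right _
    by_cases hpn : n < p
    · haveI := W.subsingleton_obj hX (i := 2 * p) (by omega)
      exact eq_zero_of_subsingleton_left _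
    by_cases hZq : Nontrivial (W.obj Z (2 * q)); swap
    · rw [not_nontrivial_iff_subsingleton] at hZq
      exact eq_zero_of_subsingleton_right _
    -- the main case: `p ≤ n`, `q ≤ m`, `H^{2q}(Z) ≠ 0`; every contraction of `a_{2p,2q}` vanishes
    haveI := W.finite_obj hZ (2 * q)
    have hh : 2 * q + 2 * (m - q) = 2 * m := by omega
    haveI := W.isPerfPair_cupPairing hZ (2 * q) (2 * (m - q)) hh
    have key : W.kunnethComponent hX hZ (2 * p) (2 * q) hij a ∈
        Submodule.map₂ (TensorProduct.mk K (W.obj X (2 * p)) (W.obj Z (2 * q))) ⊥ ⊤ := by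
      refine mem_map₂_top_of_forall_rid_lTensor_mem _ fun φ ↦ ?_
      obtain ⟨b', rfl⟩ :=
        (LinearMap.IsPerfPair.bijective_right (W.cupPairing Z m (2 * q) (2 * (m - q)) hh)).2 φ
      rw [← W.pushforward_fst_cup_snd_eq_rid_lTensor_kunnethComponent hX hZ hij hh
        (s := 2 * (c + (m - q))) (by omega) (d' := 2 * (n - p)) (by omega) (by omega) a b',
        Submodule.mem_bot]
      refine hD p q (n - p) (by omega) (by omega) hZq _
        (W.pushforward_fst_cup_snd_mem_algebraicClasses hX hZ (r := c + (m - q)) rfl (by omega) (by omega)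
          (by omega) ha (by rw [hZalg]; exact Submodule.mem_top)) fun x' hx' ↦ ?_
      -- `⟨pr_{X*}(a ∪ pr_Z^* b′), x′⟩_X = ⟨a, x′ × b′⟩_{X×Z} = 0`
      rw [← W.cupPairing_right_externalCup hX hZ (show 2 * (n - p) + 2 * (m - q) = 2 * c' by omega) h
        _ _ _ (Or.inl ⟨n - p, two_mul _⟩) a x' b']
      exact hperp _ (W.map₂_externalCup_algebraicClasses_top_le hX hZ (by omega) (hZalg (m - q)) _
        (Submodule.apply_mem_map₂ _ hx' Submodule.mem_top))
    rwa [Submodule.map₂_bot_left, Submodule.mem_bot] at key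
  · exact W.kunnethComponent_eq_zero_of_odd_right hX hZ hZodd hj hij a

/-- **Hom = num ascends from `X` to `X × Z`, bidegree form**: for `Z` with `K·A^q(Z) = H^{2q}(Z)` for all
`q` and `b_{odd}(Z) = 0`, if `K·Aᵖ(X) × K·A^{n−p}(X) → K` has trivial left kernel for every `p + q = c`
with `H^{2q}(Z) ≠ 0`, then `K·Aᶜ(X × Z) × K·A^{c′}(X × Z) → K` (`c + c′ = n + m`) has trivial left kernel
(`a = Σ ext(a_{i,j})` with all `a_{i,j} = 0`, `kunnethComponent_eq_zero_of_forall_cupPairing_eq_zero`).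
[cite: Kleiman1968AlgebraicCycles, §3 and §1.2 (A)–(B)] [cite: Kahn2020, §6.4 Prop. 6.11–6.12 and §6.12.2]
[cite: Fulton1998, Ex. 1.10.2] -/
theorem homNum_tensor_of_forall (hX : IsSmoothProjective n X) (hZ : IsSmoothProjective m Z)
    (hZalg : ∀ q, W.algebraicClasses Z q = ⊤) (hZodd : ∀ j, Odd j → Module.finrank K (W.obj Z j) = 0)
    {c c' : ℕ} (hcc' : c + c' = n + m) (h : 2 * c + 2 * c' = 2 * (n + m))
    (hD : ∀ p q p' : ℕ, p + q = c → (hp : 2 * p + 2 * p' = 2 * n) → Nontrivial (W.obj Z (2 * q)) →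
      ∀ x ∈ W.algebraicClasses X p, (∀ x' ∈ W.algebraicClasses X p',
        W.cupPairing X n (2 * p) (2 * p') hp x x' = 0) → x = 0) :
    ∀ a ∈ W.algebraicClasses (X ⊗ Z) c, (∀ a' ∈ W.algebraicClasses (X ⊗ Z) c',
        W.cupPairing (X ⊗ Z) (n + m) (2 * c) (2 * c') h a a' = 0) → a = 0 := by
  intro a ha hperp
  rw [← W.sum_extTensor_kunnethComponent hX hZ a]
  exact Finset.sum_eq_zero fun ij _ ↦ by
    rw [W.kunnethComponent_eq_zero_of_forall_cupPairing_eq_zero hX hZ hZalg hZodd hcc' h hD ha hperp,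
      map_zero]

/-- **Hom = num on `X × Z` iff on `X` in the relevant bidegrees**: for `Z` with fully algebraic cohomology
(`K·A^q(Z) = H^{2q}(Z)` for all `q`, `b_{odd}(Z) = 0`) and `c + c′ = n + m`, the pairing
`K·Aᶜ(X × Z) × K·A^{c′}(X × Z) → K` has trivial left kernel iff `K·Aᵖ(X) × K·A^{p′}(X) → K` has for every
`p + q = c`, `p + p′ = n` with `H^{2q}(Z) ≠ 0`. [cite: Kleiman1968AlgebraicCycles, §3 and §1.2 (A)–(B)]
[cite: Kahn2020, §6.4 Prop. 6.11–6.12 and §6.12.2] -/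
theorem homNum_tensor_iff (hX : IsSmoothProjective n X) (hZ : IsSmoothProjective m Z)
    (hZalg : ∀ q, W.algebraicClasses Z q = ⊤) (hZodd : ∀ j, Odd j → Module.finrank K (W.obj Z j) = 0)
    {c c' : ℕ} (hcc' : c + c' = n + m) (h : 2 * c + 2 * c' = 2 * (n + m)) :
    (∀ a ∈ W.algebraicClasses (X ⊗ Z) c, (∀ a' ∈ W.algebraicClasses (X ⊗ Z) c',
        W.cupPairing (X ⊗ Z) (n + m) (2 * c) (2 * c') h a a' = 0) → a = 0) ↔
      ∀ p q p' : ℕ, p + q = c → (hp : 2 * p + 2 * p' = 2 * n) → Nontrivial (W.obj Z (2 * q)) →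
        ∀ x ∈ W.algebraicClasses X p, (∀ x' ∈ W.algebraicClasses X p',
          W.cupPairing X n (2 * p) (2 * p') hp x x' = 0) → x = 0 :=
  ⟨fun hD _ _ _ hpq hp hZq ↦ W.homNum_of_homNum_tensor hX hZ hZalg hpq (by omega) hcc' hZq h hp hD,
    fun hD ↦ W.homNum_tensor_of_forall hX hZ hZalg hZodd hcc' h hD⟩

/-! ### §4 The standard conjecture `D` for `X × Z` and `X × 𝐏ʳ` -/

/-- **`D(X) ⟹ D(X × Z)` for `Z` with fully algebraic cohomology** (`K·A^q(Z) = H^{2q}(Z)` for all `q`,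
`b_{odd}(Z) = 0`; e.g. `Z` cellular): homological and numerical equivalence agree on `X × Z` (with
`ℚ`-coefficients, in every codimension) as soon as they agree on `X` — §3 together with the passage between
`ℚ`-classes and their `K`-spans (`homNum_iff_algebraicClasses`).  For `Z = 𝐏¹` this is the case
`∼ ∈ {hom, num}` of `A_∼(X × 𝐏¹) = A_∼(X) ⊕ A_∼(X)` (Kahn (6.4.1)). [cite: Kahn2020, §6.4 Prop. 6.11 (6.4.1)–Prop. 6.12 and §6.12.2]
[cite: Kleiman1968AlgebraicCycles, §3] [cite: Fulton1998, Ex. 1.10.2] -/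
theorem standardConjectureD_tensor_of_standardConjectureD (hX : IsSmoothProjective n X)
    (hZ : IsSmoothProjective m Z) (hZalg : ∀ q, W.algebraicClasses Z q = ⊤)
    (hZodd : ∀ j, Odd j → Module.finrank K (W.obj Z j) = 0) (hD : W.StandardConjectureD n X) :
    W.StandardConjectureD (n + m) (X ⊗ Z) := by
  have hXZ := IsSmoothProjective.tensor_holds hX hZ
  intro c c' hcc'
  refine (W.homNum_iff_algebraicClasses hXZ hcc' _).mpr ?_
  exact W.homNum_tensor_of_forall hX hZ hZalg hZodd hcc' _ fun p q p' _ hp hZq ↦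
    (W.homNum_iff_algebraicClasses hX (show p + p' = n by omega) hp).mp (hD p p' (by omega))

/-- **`D(X × Z) ⟺ D(X)` for `Z` with fully algebraic cohomology** (`⟹` is Kleiman's reduction, the tree's
`standardConjectureD_of_standardConjectureD_tensor`, valid for every smooth projective `Z`).
[cite: Kleiman1968AlgebraicCycles, §3] [cite: Kahn2020, §6.4 Prop. 6.11–6.12 and §6.12.2] -/
theorem standardConjectureD_tensor_iff (hX : IsSmoothProjective n X) (hZ : IsSmoothProjective m Z)
    (hZalg : ∀ q, W.algebraicClasses Z q = ⊤) (hZodd : ∀ j, Odd j → Module.finrank K (W.obj Z j) = 0) :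
    W.StandardConjectureD (n + m) (X ⊗ Z) ↔ W.StandardConjectureD n X :=
  ⟨W.standardConjectureD_of_standardConjectureD_tensor hX hZ,
    W.standardConjectureD_tensor_of_standardConjectureD hX hZ hZalg hZodd⟩

/-- **`D(X × Z)` for `X`, `Z` both with fully algebraic cohomology** (`b_{odd}(Z) = 0`), e.g. products of
projective spaces and Grassmannians: then `K·A(X × Z) = H^{ev}(X × Z)` (row g53-#1) and Poincaré duality
gives `D` (the tree's `standardConjectureD_of_algebraicClasses_eq_top`). [cite: Kleiman1968AlgebraicCycles, §3 and §1.2 (A)]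
[cite: Fulton1998, Ex. 1.10.2] -/
theorem standardConjectureD_tensor_of_algebraicClasses_eq_top (hX : IsSmoothProjective n X)
    (hZ : IsSmoothProjective m Z) (hXalg : ∀ p, W.algebraicClasses X p = ⊤)
    (hZalg : ∀ q, W.algebraicClasses Z q = ⊤) (hZodd : ∀ j, Odd j → Module.finrank K (W.obj Z j) = 0) :
    W.StandardConjectureD (n + m) (X ⊗ Z) :=
  W.standardConjectureD_tensor_of_standardConjectureD hX hZ hZalg hZodd
    (W.standardConjectureD_of_algebraicClasses_eq_top hX hXalg)

end WeilCohomology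

namespace GaloisWeilCohomology

variable {k : Type u} [Field k] [Finite k] {K : Type v} [Field K] [CharZero K]
  {χ : Field.absoluteGaloisGroup k →* Kˣ} (E : GaloisWeilCohomology k K χ)
variable {n : ℕ} {X : SchemeOver k}

/-- **`D(X × 𝐏ʳ) ⟺ D(X)`** over a finite field, in a Galois-compatible Weil cohomology with the Lefschetz
trace formula, `χ(φ_arith) = q` and the Riemann hypothesis for `𝐏ʳ` (which make every class on `𝐏ʳ`
algebraic and `b_{odd}(𝐏ʳ) = 0`, the tree's `algebraicClasses_projectiveSpace_eq_top`,
`finrank_projectiveSpace_of_odd`). [cite: Kahn2020, §6.4 Prop. 6.11 (6.4.1)–Prop. 6.12 and §6.12.2]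
[cite: Kleiman1968AlgebraicCycles, §3] [cite: Hartshorne1977, App. C Ex. 5.2] -/
theorem standardConjectureD_tensor_projectiveSpace_iff (hE : E.HasLefschetzTraceFormula)
    (hχ : ((χ (arithFrob k) : Kˣ) : K) = Nat.card k) {r : ℕ}
    (hRH : E.WeilRiemannHypothesisFor (projectiveSpace r k) r) (hX : IsSmoothProjective n X) :
    E.StandardConjectureD (n + r) (X ⊗ projectiveSpace r k) ↔ E.StandardConjectureD n X :=
  E.standardConjectureD_tensor_iff hX (isSmoothProjective_projectiveSpace_holds k r)
    (E.algebraicClasses_projectiveSpace_eq_top hE hχ hRH) (fun _ hj ↦ E.finrank_projectiveSpace_of_odd hE hχ hRH hj)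

/-- **`D(𝐏ᵃ × 𝐏ʳ)`** over a finite field (same hypotheses, RH for both factors).
[cite: Kleiman1968AlgebraicCycles, §3] [cite: Hartshorne1977, App. C Ex. 5.2] -/
theorem standardConjectureD_projectiveSpace_tensor_projectiveSpace (hE : E.HasLefschetzTraceFormula)
    (hχ : ((χ (arithFrob k) : Kˣ) : K) = Nat.card k) {a r : ℕ}
    (hRHa : E.WeilRiemannHypothesisFor (projectiveSpace a k) a)
    (hRH : E.WeilRiemannHypothesisFor (projectiveSpace r k) r) :
    E.StandardConjectureD (a + r) (projectiveSpace a k ⊗ projectiveSpace r k) :=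
  (E.standardConjectureD_tensor_projectiveSpace_iff hE hχ hRH (isSmoothProjective_projectiveSpace_holds k a)).mpr
    (E.standardConjectureD_projectiveSpace hE hχ hRHa)

end GaloisWeilCohomology

end Literature.AlgebraicGeometry.Motives
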